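import Literature.Analysis.FluidPDE.KwonSpaceTimeFields
import Literature.Analysis.FluidPDE.KwonHarmonicPartSecond
import Literature.Analysis.FluidPDE.NewtonPotentialGradient
import Literature.Analysis.Convolution.YoungInequality
import HarnessLib

/-!
# Kwon's Lemma 2.5: the pressure class `q ∈ L^{3/2}` and (est.q) at `r = m = 3`

Analysis/FluidPDE file (theorems only) on the discharge path of the named fact
`Literature.Analysis.FluidPDE.kwon2023_velocity_epsilon_regularity`
(`PressureFreeEpsilonRegularity.lean`; H. Kwon, J. Differential Equations (2023) =
arXiv:2104.03160, Thm. 1.4): the PRESSURE estimates of Lemma 2.5 for Kwon's explicit pressure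
`q(t) = q_{W(t)}` of the perturbed system (`Kwon2023.pressureField W P`,
`KwonSpaceTimeFields.lean`; `Kwon2023.kwonSlicePressure`, `KwonSliceMomentum.lean`):

`q = (Π − Λ[Π]) − P_{(W·∇φ)W} − Σᵢ (∂ᵢk) ⋆ ((WᵢW)·∇φ) + π[φ♭(h·∇)h]`,

`Π = Π[√φ W(t)]` the Riesz (Calderón–Zygmund) pressure of the weighted slice, `Λ` the smoothing
remainder of the truncated Newtonian potential, `P_g` the shell pressure, `k` the annular
kernel, `π[F] = Δ⁻¹ div F` the divergence potential of the cut-off self-stretching of the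
harmonic part `h = H(W(t))`. PRINTED (arXiv p. 7, Lemma 2.5 (est.q)):
"`‖q‖_{L^{r/2}_tL^{m/2}_x(Q₁)} ≲ ‖u‖²_{L^r_tL^m_x(Q₂)}`", and Def. 2.4: `q ∈ L^{3/2}`. Here
`r = m = 3` (the case used in §4 for Thm. 1.4):

* slice SUP bounds for the three local pieces — `Kwon2023.exists_norm_shellPressure_convect_le`
  (`|P_{(U·∇φ)U}| ≤ C ∫|U|²`), `Kwon2023.exists_norm_potentialDeriv_convect_le`
  (`|(∂ᵢk) ⋆ ((UᵢU)·∇φ)| ≤ C ∫|U|²`), `Kwon2023.exists_norm_fderiv_selfStretch_le` and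
  `Kwon2023.exists_abs_divPotential_selfStretch_le` (`|π[φ♭(h·∇)h]| ≤ C (∫_{B₂}|U|)²`, the
  Newtonian potential of the bounded compactly supported density `div F`, `|div F| ≤ 3‖DF‖`,
  `‖DF‖ ≲ (∫_{B₂}|U|)²` by (est.h) at orders `0, 1, 2`);
* the Calderón–Zygmund piece in `L^{3/2}` — `Kwon2023.eLpNorm_newtonFarSmoothing_le` (Young:
  `‖Λ[g]‖_{3/2} ≤ ‖λ‖₁‖g‖_{3/2}`), `Kwon2023.eLpNorm_sub_newtonFarSmoothing_le`;
* the slice estimate `Kwon2023.exists_eLpNorm_pressureField_slice_le`: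
  `‖q(t)‖_{L^{3/2}(B₁)} ≤ (1 + ‖λ‖₁)‖P(t)‖_{3/2} + |B₁|^{2/3} A (‖W(t)‖₂² + ‖W(t)‖²_{L¹(B₂)})`;
* space–time, by Tonelli with Stein's slice bound `‖P(t)‖_{3/2} ≤ C_S‖W(t)‖₃²`
  (`Kwon2023.exists_rieszRepresentative`): `Kwon2023.exists_setLIntegral_pressureField_le`
  (`∫∫_{T×B₁}|q|^{3/2} ≤ c ∫∫_{T×B₂}|W|³`), **the `pressure` and `locallyIntegrableOn_pressure`
  fields of `Kwon2023.IsPerturbedSuitableOn O … q`** for every `O ⊆ (−4,0) × B₁`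
  (`Kwon2023.setLIntegral_pressureField_rpow_lt_top`, `Kwon2023.locallyIntegrableOn_pressureField`,
  `Kwon2023.integrableOn_pressureField`), and **(est.q) in the form of the §4 assembly**
  `Kwon2023.exists_eLpNorm_pressureField_le`:
  `‖q‖_{L^{3/2}(Q₁(0))} ≤ C ‖W‖²_{L³(Q₂(0))}`; `Kwon2023.exists_pressureField_representative`
  packages it with `exists_rieszRepresentative`.

No NS-regularity statement is touched: these are estimates of a printed lemma on the way to
re-proving the INPUT Thm. 1.4 (the binder `h25` of
`kwon2023_velocity_epsilon_regularity_of_lemma25_of_thm31`, `PressureFreeEpsilonRegularityAssembly.lean`).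

## Mathlib / tree search

Tree (reused): `Kwon2023.pressureField`, `IsGoodVelocity`, `exists_rieszRepresentative`,
`stronglyMeasurable_uncurry_pressureField/shellPressure/potentialDeriv_scalar/divPotential_selfStretch`
(`KwonSpaceTimeFields`); `shellPressure`, `norm_shellPressure_le`, `selfStretch`,
`contDiff_selfStretch`, `kwonFlatCutoff`, `integrable_scalarDensity_smul` (`KwonConvectiveTransposes`);
`integrable_coord_smul` (`KwonSliceMomentum`); `scalarDensity`, `norm_scalarDensity_le`,
`integrable_scalarDensity/vectorDensity`, `exists_norm(_fderiv)_harmonicPart_le`,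
`exists_bound_fderiv_annularKernel`, `exists_bound_gradient_kwonCutoff`, `contDiff_harmonicPart`
(`KwonHarmonicPart`); `exists_norm_fderiv_fderiv_harmonicPart_apply_le` (`KwonHarmonicPartSecond`);
`exists_bound_gradient_annularKernel` (`KwonLocalLerayDuality`); `divPotential_apply`,
`contDiff_divergence_of_contDiff_top` (`ClassicalLerayProjection`);
`abs_integral_newtonKernel_mul_le` (`NewtonPotentialGradient`); `newtonFarSmoothing_eq_convolution`,
`integrable_newtonFarLaplacian` (`NewtonLocalPotential`, `HarmonicProbe`);
`divergence_eq_zero_of_notMem_tsupport` (`WholeSpaceIBP`); `divergence_eq_sum_inner_fderiv`;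
`tsupport_radialCutoff_subset` (`NewtonKernel`); `steinConstThreeHalves` (`RieszPressureLp`);
Young `Literature.Analysis.Convolution.eLpNorm_convolution_le_young` (`Convolution/YoungInequality`).
Mathlib: `eLpNorm_add_le`, `eLpNorm_sub_le`, `eLpNorm_le_of_ae_bound`, `eLpNorm_mono_measure`,
`eLpNorm_le_eLpNorm_mul_rpow_measure_univ`, `eLpNorm_restrict_eq_of_support_subset`,
`setLIntegral_prod`, `lintegral_mono_ae`, `HasFDerivAt.clm_apply`, `HasFDerivAt.smul`,
`fderiv_clm_apply`, `ContinuousLinearMap.opNorm_flip`, `norm_smulRight_apply`, `MemLp.integrable`.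

## References

* H. Kwon, *The role of the pressure in the regularity theory for the Navier–Stokes equations*,
  J. Differential Equations 357 (2023) = arXiv:2104.03160: Lemma 2.5 (est.q), its proof
  (arXiv p. 8–9), Remark 2.3 (est.h), Def. 2.4, §4 (p. 15). [Kwon2023RolePressure]
-/

noncomputable section

open MeasureTheory Set Function Filter Topology TopologicalSpace Metric InnerProductSpace
  ContinuousLinearMap
open scoped NNReal ENNReal RealInnerProductSpace Convolution ContDiff

namespace Literature.Analysis.FluidPDE

namespace Kwon2023

/-! ### Slice sup bounds for the three local pressure pieces -/

section SliceSup

variable {U : EuclideanSpace ℝ (Fin 3) → EuclideanSpace ℝ (Fin 3)}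

/-- `‖Uᵢ U‖ ≤ ‖U‖²`. [folklore] -/
private theorem norm_coord_smul_le (U : EuclideanSpace ℝ (Fin 3) → EuclideanSpace ℝ (Fin 3))
    (i : Fin 3) (x : EuclideanSpace ℝ (Fin 3)) : ‖U x i • U x‖ ≤ ‖U x‖ ^ 2 := by
  rw [norm_smul]
  calc ‖U x i‖ * ‖U x‖ ≤ ‖U x‖ * ‖U x‖ :=
        mul_le_mul_of_nonneg_right (by simpa using PiLp.norm_apply_le (p := 2) (U x) i) (norm_nonneg _)
    _ = ‖U x‖ ^ 2 := by ring

/-- **Sup bound for the shell pressure of `(U·∇φ)U`**: `|P_{(U·∇φ)U}(y)| ≤ C ∫ |U|²`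
(`|P_g| ≤ ‖∇k‖_∞ ‖g‖₁`, `|(U·∇φ)U| ≤ ‖∇φ‖_∞ |U|²`). [cite: Kwon2023RolePressure, Lemma 2.5 (proof, p. 8–9), (est.q)] -/
theorem exists_norm_shellPressure_convect_le :
    ∃ C : ℝ, 0 ≤ C ∧ ∀ (U : EuclideanSpace ℝ (Fin 3) → EuclideanSpace ℝ (Fin 3)),
      AEStronglyMeasurable U volume → Integrable (fun x => ‖U x‖ ^ 2) →
      ∀ y, ‖shellPressure (fun x => scalarDensity U x • U x) y‖ ≤ C * ∫ x, ‖U x‖ ^ 2 := by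
  obtain ⟨K, hK0, hK⟩ := exists_bound_gradient_annularKernel
  obtain ⟨Cφ, hCφ0, hCφ⟩ := exists_bound_gradient_kwonCutoff
  refine ⟨K * Cφ, by positivity, fun U hUm hU2 y => ?_⟩
  have hg := integrable_scalarDensity_smul hUm hU2
  refine (norm_shellPressure_le hg hK y).trans ?_
  rw [mul_assoc]
  refine mul_le_mul_of_nonneg_left ?_ hK0
  rw [← integral_const_mul]
  refine integral_mono_of_nonneg (Eventually.of_forall fun x => norm_nonneg _) (hU2.const_mul Cφ)
    (Eventually.of_forall fun x => ?_)
  dsimp only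
  rw [norm_smul]
  calc ‖scalarDensity U x‖ * ‖U x‖ ≤ (Cφ * ‖U x‖) * ‖U x‖ :=
        mul_le_mul_of_nonneg_right (norm_scalarDensity_le hCφ x) (norm_nonneg _)
    _ = Cφ * ‖U x‖ ^ 2 := by ring

/-- **Sup bound for the harmonic-part pressures of the convective densities**:
`|((∂ᵢk) ⋆ ((UᵢU)·∇φ))(y)| ≤ C ∫ |U|²`. [cite: Kwon2023RolePressure, Lemma 2.5 (proof, p. 8–9), (est.q)] -/
theorem exists_norm_potentialDeriv_convect_le :
    ∃ C : ℝ, 0 ≤ C ∧ ∀ (U : EuclideanSpace ℝ (Fin 3) → EuclideanSpace ℝ (Fin 3)),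
      AEStronglyMeasurable U volume → Integrable (fun x => ‖U x‖ ^ 2) →
      ∀ (i : Fin 3) y, ‖((fun z => fderiv ℝ annularKernel z (EuclideanSpace.single i (1 : ℝ))) ⋆
        scalarDensity (fun x => U x i • U x)) y‖ ≤ C * ∫ x, ‖U x‖ ^ 2 := by
  obtain ⟨K, hK0, hK⟩ := exists_bound_fderiv_annularKernel
  obtain ⟨Cφ, hCφ0, hCφ⟩ := exists_bound_gradient_kwonCutoff
  refine ⟨K * Cφ, by positivity, fun U hUm hU2 i y => ?_⟩
  set g : EuclideanSpace ℝ (Fin 3) → ℝ := scalarDensity (fun x => U x i • U x) with hgdef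
  have hUi : IntegrableOn (fun x => U x i • U x) (ball (0 : EuclideanSpace ℝ (Fin 3)) 2) :=
    (integrable_coord_smul hUm hU2 i).integrableOn
  have hgi : Integrable g := integrable_scalarDensity hUi
  have hK1 : ∀ z, ‖fderiv ℝ annularKernel z (EuclideanSpace.single i (1 : ℝ))‖ ≤ K := fun z => by
    simpa using hK z (EuclideanSpace.single i (1 : ℝ))
  rw [convolution_lsmul]
  calc ‖∫ t, fderiv ℝ annularKernel t (EuclideanSpace.single i (1 : ℝ)) • g (y - t)‖
      ≤ ∫ t, K * ‖g (y - t)‖ := by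
        refine norm_integral_le_of_norm_le ((hgi.comp_sub_left y).norm.const_mul K)
          (Eventually.of_forall fun t => ?_)
        rw [norm_smul]
        exact mul_le_mul_of_nonneg_right (hK1 t) (norm_nonneg _)
    _ = K * ∫ t, ‖g t‖ := by
        rw [integral_const_mul]
        congr 1
        exact integral_sub_left_eq_self (fun t => ‖g t‖) volume y
    _ ≤ K * (Cφ * ∫ x, ‖U x‖ ^ 2) := by
        refine mul_le_mul_of_nonneg_left ?_ hK0
        rw [← integral_const_mul]
        refine integral_mono_of_nonneg (Eventually.of_forall fun x => norm_nonneg _) (hU2.const_mul Cφ)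
          (Eventually.of_forall fun x => ?_)
        dsimp only
        rw [hgdef]
        calc ‖scalarDensity (fun x => U x i • U x) x‖ ≤ Cφ * ‖U x i • U x‖ := norm_scalarDensity_le hCφ x
          _ ≤ Cφ * ‖U x‖ ^ 2 := mul_le_mul_of_nonneg_left (norm_coord_smul_le U i x) hCφ0
    _ = K * Cφ * ∫ x, ‖U x‖ ^ 2 := by ring

/-- `|div V(x)| ≤ 3 ‖DV(x)‖` on `ℝ³`. [folklore] -/
private theorem abs_divergence_le_three (V : EuclideanSpace ℝ (Fin 3) → EuclideanSpace ℝ (Fin 3))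
    (x : EuclideanSpace ℝ (Fin 3)) : |VectorCalculus.divergence V x| ≤ 3 * ‖fderiv ℝ V x‖ := by
  set b := EuclideanSpace.basisFun (Fin 3) ℝ
  rw [divergence_eq_sum_inner_fderiv b]
  calc |∑ i, ⟪b i, fderiv ℝ V x (b i)⟫| ≤ ∑ i, |⟪b i, fderiv ℝ V x (b i)⟫| :=
        Finset.abs_sum_le_sum_abs _ _
    _ ≤ ∑ _i : Fin 3, ‖fderiv ℝ V x‖ := Finset.sum_le_sum fun i _ => by
        calc |⟪b i, fderiv ℝ V x (b i)⟫| ≤ ‖b i‖ * ‖fderiv ℝ V x (b i)‖ := abs_real_inner_le_norm _ _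
          _ ≤ ‖b i‖ * (‖fderiv ℝ V x‖ * ‖b i‖) :=
              mul_le_mul_of_nonneg_left (le_opNorm _ _) (norm_nonneg _)
          _ = ‖fderiv ℝ V x‖ := by rw [b.orthonormal.1 i]; ring
    _ = 3 * ‖fderiv ℝ V x‖ := by simp

/-- **Derivative bound for the self-stretching** `F = φ♭ (h·∇)h`, `h = H U`:
`‖DF(x)‖ ≤ D₀ (∫_{B₂}|U|)²` ((est.h) at orders 0, 1, 2). [cite: Kwon2023RolePressure, Remark 2.3 (est.h)] -/
theorem exists_norm_fderiv_selfStretch_le :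
    ∃ D : ℝ, 0 ≤ D ∧ ∀ (U : EuclideanSpace ℝ (Fin 3) → EuclideanSpace ℝ (Fin 3)),
      IntegrableOn U (ball (0 : EuclideanSpace ℝ (Fin 3)) 2) →
      ∀ x, ‖fderiv ℝ (selfStretch U) x‖ ≤
        D * (∫ y in ball (0 : EuclideanSpace ℝ (Fin 3)) 2, ‖U y‖) ^ 2 := by
  obtain ⟨C₀, hC₀0, hC₀⟩ := exists_norm_harmonicPart_le
  obtain ⟨C₁, hC₁0, hC₁⟩ := exists_norm_fderiv_harmonicPart_le
  obtain ⟨C₂, hC₂0, hC₂⟩ := exists_norm_fderiv_fderiv_harmonicPart_apply_le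
  obtain ⟨Cf, hCf⟩ := ((contDiff_kwonFlatCutoff (n := 1)).continuous_fderiv one_ne_zero).bounded_above_of_compact_support
    (hasCompactSupport_kwonFlatCutoff.fderiv (𝕜 := ℝ))
  have hCf0 : 0 ≤ Cf := (norm_nonneg _).trans (hCf 0)
  refine ⟨(C₁ ^ 2 + C₂ * C₀) + Cf * (C₁ * C₀), by positivity, fun U hU x => ?_⟩
  set I : ℝ := ∫ y in ball (0 : EuclideanSpace ℝ (Fin 3)) 2, ‖U y‖ with hI
  have hI0 : 0 ≤ I := integral_nonneg fun y => norm_nonneg _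
  set h := harmonicPart U with hh
  have hsm : ContDiff ℝ 2 h :=
    contDiff_harmonicPart (integrable_scalarDensity hU).locallyIntegrable
      (integrable_vectorDensity hU).locallyIntegrable
  have hd1 : ContDiff ℝ 1 (fderiv ℝ h) := hsm.fderiv_right (m := 1) le_rfl
  have hhx : HasFDerivAt h (fderiv ℝ h x) x := (hsm.differentiable (by norm_num) x).hasFDerivAt
  have hcx : HasFDerivAt (fderiv ℝ h) (fderiv ℝ (fderiv ℝ h) x) x :=
    (hd1.differentiable one_ne_zero x).hasFDerivAt
  -- the second derivative as a bilinear map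
  have hD2 : ‖fderiv ℝ (fderiv ℝ h) x‖ ≤ C₂ * I := by
    refine opNorm_le_bound _ (by positivity) fun w => ?_
    refine opNorm_le_bound _ (by positivity) fun a => ?_
    have e : fderiv ℝ (fderiv ℝ h) x w a = fderiv ℝ (fun y => fderiv ℝ h y a) x w := by
      rw [fderiv_clm_apply (hd1.differentiable one_ne_zero x) (differentiableAt_const a)]
      simp
    rw [e]
    calc ‖fderiv ℝ (fun y => fderiv ℝ h y a) x w‖ ≤ ‖fderiv ℝ (fun y => fderiv ℝ h y a) x‖ * ‖w‖ :=
          le_opNorm _ _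
      _ ≤ (C₂ * ‖a‖ * I) * ‖w‖ := mul_le_mul_of_nonneg_right (hC₂ U hU x a) (norm_nonneg _)
      _ = C₂ * I * ‖w‖ * ‖a‖ := by ring
  -- the field `V = (h·∇)h = Dh(h)`
  set V : EuclideanSpace ℝ (Fin 3) → EuclideanSpace ℝ (Fin 3) := fun y => fderiv ℝ h y (h y) with hV
  have hVx : HasFDerivAt V ((fderiv ℝ h x).comp (fderiv ℝ h x) +
      (fderiv ℝ (fderiv ℝ h) x).flip (h x)) x := hcx.clm_apply hhx
  have hVn : ‖V x‖ ≤ C₁ * C₀ * I ^ 2 := by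
    calc ‖V x‖ ≤ ‖fderiv ℝ h x‖ * ‖h x‖ := le_opNorm _ _
      _ ≤ (C₁ * I) * (C₀ * I) := mul_le_mul (hC₁ U hU x) (hC₀ U hU x) (norm_nonneg _) (by positivity)
      _ = C₁ * C₀ * I ^ 2 := by ring
  have hDVn : ‖(fderiv ℝ h x).comp (fderiv ℝ h x) + (fderiv ℝ (fderiv ℝ h) x).flip (h x)‖ ≤
      (C₁ ^ 2 + C₂ * C₀) * I ^ 2 := by
    refine (norm_add_le _ _).trans ?_
    have h1 : ‖(fderiv ℝ h x).comp (fderiv ℝ h x)‖ ≤ (C₁ * I) * (C₁ * I) :=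
      (opNorm_comp_le _ _).trans (mul_le_mul (hC₁ U hU x) (hC₁ U hU x) (norm_nonneg _) (by positivity))
    have h2 : ‖(fderiv ℝ (fderiv ℝ h) x).flip (h x)‖ ≤ (C₂ * I) * (C₀ * I) := by
      calc ‖(fderiv ℝ (fderiv ℝ h) x).flip (h x)‖ ≤ ‖(fderiv ℝ (fderiv ℝ h) x).flip‖ * ‖h x‖ :=
            le_opNorm _ _
        _ = ‖fderiv ℝ (fderiv ℝ h) x‖ * ‖h x‖ := by rw [opNorm_flip]
        _ ≤ (C₂ * I) * (C₀ * I) := mul_le_mul hD2 (hC₀ U hU x) (norm_nonneg _) (by positivity)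
    nlinarith
  -- `F = φ♭ • V`
  have hφx : HasFDerivAt kwonFlatCutoff (fderiv ℝ kwonFlatCutoff x) x :=
    ((contDiff_kwonFlatCutoff (n := 1)).differentiable one_ne_zero x).hasFDerivAt
  have hFx : HasFDerivAt (selfStretch U) (kwonFlatCutoff x • ((fderiv ℝ h x).comp (fderiv ℝ h x) +
      (fderiv ℝ (fderiv ℝ h) x).flip (h x)) + (fderiv ℝ kwonFlatCutoff x).smulRight (V x)) x :=
    hφx.smul hVx
  rw [hFx.fderiv]
  refine (norm_add_le _ _).trans ?_
  have hφ1 : ‖kwonFlatCutoff x‖ ≤ 1 := by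
    rw [Real.norm_eq_abs, kwonFlatCutoff, abs_of_nonneg (radialCutoff_nonneg _ _ x)]
    exact radialCutoff_le_one _ _ x
  have h1 : ‖kwonFlatCutoff x • ((fderiv ℝ h x).comp (fderiv ℝ h x) +
      (fderiv ℝ (fderiv ℝ h) x).flip (h x))‖ ≤ 1 * ((C₁ ^ 2 + C₂ * C₀) * I ^ 2) := by
    rw [norm_smul]
    exact mul_le_mul hφ1 hDVn (norm_nonneg _) zero_le_one
  have h2 : ‖(fderiv ℝ kwonFlatCutoff x).smulRight (V x)‖ ≤ Cf * (C₁ * C₀ * I ^ 2) := by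
    rw [norm_smulRight_apply]
    exact mul_le_mul (hCf x) hVn (norm_nonneg _) hCf0
  nlinarith

/-- The self-stretching is supported in the closed ball of radius `9/8`. [folklore] -/
private theorem tsupport_selfStretch_subset (U : EuclideanSpace ℝ (Fin 3) → EuclideanSpace ℝ (Fin 3)) :
    tsupport (selfStretch U) ⊆ closedBall (0 : EuclideanSpace ℝ (Fin 3)) (9 / 8) :=
  (tsupport_smul_subset_left _ _).trans (tsupport_radialCutoff_subset (by norm_num) (by norm_num))

/-- **Sup bound for the pressure of the self-stretching**: `|π[φ♭(h·∇)h](y)| ≤ C (∫_{B₂}|U|)²`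
(the Newtonian potential of the bounded, compactly supported density `div F`,
`|div F| ≤ 3‖DF‖`). [cite: Kwon2023RolePressure, Lemma 2.5 (proof, p. 8–9), (est.q)] -/
theorem exists_abs_divPotential_selfStretch_le :
    ∃ C : ℝ, 0 ≤ C ∧ ∀ (U : EuclideanSpace ℝ (Fin 3) → EuclideanSpace ℝ (Fin 3)),
      IntegrableOn U (ball (0 : EuclideanSpace ℝ (Fin 3)) 2) →
      ∀ y, |divPotential (selfStretch U) y| ≤
        C * (∫ x in ball (0 : EuclideanSpace ℝ (Fin 3)) 2, ‖U x‖) ^ 2 := by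
  obtain ⟨D, hD0, hD⟩ := exists_norm_fderiv_selfStretch_le
  set v : ℝ := (volume : Measure (EuclideanSpace ℝ (Fin 3))).real
    (closedBall (0 : EuclideanSpace ℝ (Fin 3)) (9 / 8)) with hv
  have hv0 : 0 ≤ v := measureReal_nonneg
  refine ⟨3 * D * (1 + (4 * Real.pi)⁻¹ * v), by positivity, fun U hU y => ?_⟩
  set I : ℝ := ∫ x in ball (0 : EuclideanSpace ℝ (Fin 3)) 2, ‖U x‖ with hI
  set G := selfStretch U with hG
  have hGs : ContDiff ℝ ∞ G := contDiff_selfStretch hU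
  have hdivc : Continuous (VectorCalculus.divergence G) := (contDiff_divergence_of_contDiff_top hGs).continuous
  have hsupp : ∀ x, x ∉ closedBall (0 : EuclideanSpace ℝ (Fin 3)) (9 / 8) →
      VectorCalculus.divergence G x = 0 := fun x hx =>
    divergence_eq_zero_of_notMem_tsupport fun h => hx (tsupport_selfStretch_subset U h)
  have hdivcs : HasCompactSupport (VectorCalculus.divergence G) := by
    refine HasCompactSupport.of_support_subset_isCompact (isCompact_closedBall 0 (9 / 8)) fun x hx => ?_
    by_contra h
    exact hx (hsupp x h)
  have hB : ∀ x, |VectorCalculus.divergence G x| ≤ 3 * D * I ^ 2 := fun x =>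
    (abs_divergence_le_three G x).trans (by
      have := hD U hU x
      nlinarith)
  have hL1 : ∫ x, |VectorCalculus.divergence G x| ≤ 3 * D * I ^ 2 * v := by
    rw [← setIntegral_eq_integral_of_forall_compl_eq_zero (s := closedBall (0 : EuclideanSpace ℝ (Fin 3)) (9 / 8))
      (fun x hx => by rw [hsupp x hx, abs_zero])]
    refine (Real.le_norm_self _).trans ?_
    exact norm_setIntegral_le_of_norm_le_const measure_closedBall_lt_top fun x _ => by
      rw [Real.norm_eq_abs, abs_abs]; exact hB x
  rw [divPotential_apply]
  refine (abs_integral_newtonKernel_mul_le hdivc hdivcs hB y).trans ?_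
  have hπ : 0 ≤ (4 * Real.pi)⁻¹ := by positivity
  have hI2 : 0 ≤ D * I ^ 2 := by positivity
  nlinarith [mul_le_mul_of_nonneg_left hL1 hπ]

end SliceSup

/-! ### The Calderón–Zygmund piece: `‖P − Λ[P]‖_{3/2} ≤ (1 + ‖λ‖₁) ‖P‖_{3/2}` -/

section CZ

/-- The smoothing kernel `λ = Δ((1 − θ)Γ)` at radii `(3, 4)` has finite `L¹` mass. [folklore] -/
private theorem eLpNorm_newtonFarLaplacian_one_lt_top :
    eLpNorm (newtonFarLaplacian 3 4) 1 (volume : Measure (EuclideanSpace ℝ (Fin 3))) < ⊤ :=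
  (memLp_one_iff_integrable.2 (integrable_newtonFarLaplacian (by norm_num) (by norm_num))).eLpNorm_lt_top

/-- **Young for the smoothing remainder**: `‖Λ[g]‖_{L^{3/2}} ≤ ‖λ‖₁ ‖g‖_{L^{3/2}}` (Young's
convolution inequality `‖k ⋆ f‖_r ≤ ‖k‖_b ‖f‖_m`, `b = 1`, `m = r = 3/2`, for the smooth compactly
supported kernel `λ`). [cite: RobinsonRodrigoSadowskiCUP2016, Thm. A.10] -/
theorem eLpNorm_newtonFarSmoothing_le {g : EuclideanSpace ℝ (Fin 3) → ℝ} (hg : AEStronglyMeasurable g volume) :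
    eLpNorm (newtonFarSmoothing 3 4 g) (3 / 2 : ℝ≥0∞) volume ≤
      eLpNorm (newtonFarLaplacian 3 4) 1 (volume : Measure (EuclideanSpace ℝ (Fin 3))) *
        eLpNorm g (3 / 2 : ℝ≥0∞) volume := by
  rw [newtonFarSmoothing_eq_convolution]
  refine Literature.Analysis.Convolution.eLpNorm_convolution_le_young
    (integrable_newtonFarLaplacian (by norm_num) (by norm_num)).aestronglyMeasurable hg le_rfl ?_ ?_
  · rw [ENNReal.le_div_iff_mul_le (by norm_num) (by norm_num)]; norm_num
  · rw [inv_one]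

/-- `Λ[g]` is a.e.-strongly measurable for a.e.-strongly measurable `g`. [folklore] -/
private theorem aestronglyMeasurable_newtonFarSmoothing {g : EuclideanSpace ℝ (Fin 3) → ℝ}
    (hg : AEStronglyMeasurable g volume) :
    AEStronglyMeasurable (newtonFarSmoothing 3 4 g) volume := by
  rw [newtonFarSmoothing_eq_convolution]
  exact ((integrable_newtonFarLaplacian (by norm_num) (by norm_num)).aestronglyMeasurable.convolution_integrand
    (lsmul ℝ ℝ) hg).integral_prod_right'

/-- **The Calderón–Zygmund piece in `L^{3/2}`**: `‖g − Λ[g]‖_{3/2} ≤ (1 + ‖λ‖₁)‖g‖_{3/2}`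
(Minkowski and Young's convolution inequality with `b = 1`, `m = r = 3/2`).
[cite: RobinsonRodrigoSadowskiCUP2016, Thm. A.10] -/
theorem eLpNorm_sub_newtonFarSmoothing_le {g : EuclideanSpace ℝ (Fin 3) → ℝ} (hg : AEStronglyMeasurable g volume) :
    eLpNorm (fun y => g y - newtonFarSmoothing 3 4 g y) (3 / 2 : ℝ≥0∞) volume ≤
      (1 + eLpNorm (newtonFarLaplacian 3 4) 1 (volume : Measure (EuclideanSpace ℝ (Fin 3)))) *
        eLpNorm g (3 / 2 : ℝ≥0∞) volume := by
  have h32 : (1 : ℝ≥0∞) ≤ 3 / 2 := by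
    rw [ENNReal.le_div_iff_mul_le (by norm_num) (by norm_num)]; norm_num
  calc eLpNorm (fun y => g y - newtonFarSmoothing 3 4 g y) (3 / 2 : ℝ≥0∞) volume
      = eLpNorm (g - newtonFarSmoothing 3 4 g) (3 / 2 : ℝ≥0∞) volume := rfl
    _ ≤ eLpNorm g (3 / 2 : ℝ≥0∞) volume + eLpNorm (newtonFarSmoothing 3 4 g) (3 / 2 : ℝ≥0∞) volume :=
        eLpNorm_sub_le hg (aestronglyMeasurable_newtonFarSmoothing hg) h32
    _ ≤ eLpNorm g (3 / 2 : ℝ≥0∞) volume + eLpNorm (newtonFarLaplacian 3 4) 1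
          (volume : Measure (EuclideanSpace ℝ (Fin 3))) * eLpNorm g (3 / 2 : ℝ≥0∞) volume := by
        gcongr; exact eLpNorm_newtonFarSmoothing_le hg
    _ = (1 + eLpNorm (newtonFarLaplacian 3 4) 1 (volume : Measure (EuclideanSpace ℝ (Fin 3)))) *
          eLpNorm g (3 / 2 : ℝ≥0∞) volume := by ring

end CZ

/-! ### The slice estimate for Kwon's pressure on `B₁` -/

section Slice

variable {W : ℝ → EuclideanSpace ℝ (Fin 3) → EuclideanSpace ℝ (Fin 3)} {P : ℝ → EuclideanSpace ℝ (Fin 3) → ℝ}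

/-- Slices of a jointly strongly measurable map are a.e.-strongly measurable. [folklore] -/
private theorem aestronglyMeasurable_slice_of_uncurry {β : Type*} [TopologicalSpace β]
    {F : ℝ → EuclideanSpace ℝ (Fin 3) → β} (hF : StronglyMeasurable (uncurry F)) (t : ℝ)
    (μ : Measure (EuclideanSpace ℝ (Fin 3))) : AEStronglyMeasurable (F t) μ :=
  (hF.comp_measurable measurable_prodMk_left).aestronglyMeasurable

/-- `(3/2).toReal⁻¹ = 2/3`. [folklore] -/
private theorem toReal_threeHalves_inv : ((3 / 2 : ℝ≥0∞).toReal)⁻¹ = (2 / 3 : ℝ) := by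
  rw [ENNReal.toReal_div]; norm_num

/-- **The slice estimate for Kwon's pressure `q(t) = q_{W(t)}` on `B₁`** (every `t`): with
`Λ₁ = ‖λ‖_{L¹}` the mass of the smoothing kernel,
`‖q(t)‖_{L^{3/2}(B₁)} ≤ (1 + Λ₁)‖P(t)‖_{L^{3/2}} + |B₁|^{2/3} A (‖W(t)‖²_{L²} + ‖W(t)‖²_{L¹(B₂)})` —
the Calderón–Zygmund piece by Young, the three local pieces by their sup bounds.
[cite: Kwon2023RolePressure, Lemma 2.5 (proof, p. 8–9), (est.q)] -/
theorem exists_eLpNorm_pressureField_slice_le :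
    ∃ A : ℝ, 0 ≤ A ∧ ∀ (W : ℝ → EuclideanSpace ℝ (Fin 3) → EuclideanSpace ℝ (Fin 3))
      (P : ℝ → EuclideanSpace ℝ (Fin 3) → ℝ), IsGoodVelocity W → StronglyMeasurable (uncurry P) →
      ∀ t : ℝ, eLpNorm (pressureField W P t) (3 / 2 : ℝ≥0∞)
          (volume.restrict (ball (0 : EuclideanSpace ℝ (Fin 3)) 1)) ≤
        (1 + eLpNorm (newtonFarLaplacian 3 4) 1 (volume : Measure (EuclideanSpace ℝ (Fin 3)))) *
            eLpNorm (P t) (3 / 2 : ℝ≥0∞) volume +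
          volume (ball (0 : EuclideanSpace ℝ (Fin 3)) 1) ^ (2 / 3 : ℝ) *
            ENNReal.ofReal (A * ((∫ x, ‖W t x‖ ^ 2) +
              (∫ x in ball (0 : EuclideanSpace ℝ (Fin 3)) 2, ‖W t x‖) ^ 2)) := by
  obtain ⟨Csh, hCsh0, hCsh⟩ := exists_norm_shellPressure_convect_le
  obtain ⟨Ccv, hCcv0, hCcv⟩ := exists_norm_potentialDeriv_convect_le
  obtain ⟨Cπ, hCπ0, hCπ⟩ := exists_abs_divPotential_selfStretch_le
  refine ⟨Csh + 3 * Ccv + Cπ, by positivity, fun W P hW hPm t => ?_⟩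
  set μ₁ : Measure (EuclideanSpace ℝ (Fin 3)) :=
    volume.restrict (ball (0 : EuclideanSpace ℝ (Fin 3)) 1) with hμ₁
  set L : ℝ≥0∞ := eLpNorm (newtonFarLaplacian 3 4) 1 (volume : Measure (EuclideanSpace ℝ (Fin 3))) with hL
  set V : ℝ≥0∞ := volume (ball (0 : EuclideanSpace ℝ (Fin 3)) 1) ^ (2 / 3 : ℝ) with hV
  set S : ℝ := ∫ x, ‖W t x‖ ^ 2 with hS
  set I : ℝ := ∫ x in ball (0 : EuclideanSpace ℝ (Fin 3)) 2, ‖W t x‖ with hI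
  have hS0 : 0 ≤ S := integral_nonneg fun x => by positivity
  -- the four pieces
  set f₁ : EuclideanSpace ℝ (Fin 3) → ℝ := fun y => P t y - newtonFarSmoothing 3 4 (P t) y with hf₁
  set f₂ : EuclideanSpace ℝ (Fin 3) → ℝ :=
    fun y => shellPressure (fun x => scalarDensity (W t) x • W t x) y with hf₂
  set f₃ : EuclideanSpace ℝ (Fin 3) → ℝ := fun y => ∑ i, ((fun z => fderiv ℝ annularKernel z
    (EuclideanSpace.single (i : Fin 3) (1 : ℝ))) ⋆ scalarDensity (fun x => W t x i • W t x)) y with hf₃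
  set f₄ : EuclideanSpace ℝ (Fin 3) → ℝ := fun y => divPotential (selfStretch (W t)) y with hf₄
  have e : pressureField W P t = f₁ - f₂ - f₃ + f₄ := by
    funext y; rfl
  -- measurability of the pieces
  have hPt : AEStronglyMeasurable (P t) volume := aestronglyMeasurable_slice_of_uncurry hPm t _
  have m₁ : AEStronglyMeasurable f₁ μ₁ :=
    (hPt.sub (aestronglyMeasurable_newtonFarSmoothing hPt)).restrict
  have m₂ : AEStronglyMeasurable f₂ μ₁ :=
    aestronglyMeasurable_slice_of_uncurry (stronglyMeasurable_uncurry_shellPressure hW.stronglyMeasurable) t _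
  have m₃ : AEStronglyMeasurable f₃ μ₁ :=
    Finset.aestronglyMeasurable_fun_sum _ fun i _ =>
      aestronglyMeasurable_slice_of_uncurry
        (stronglyMeasurable_uncurry_potentialDeriv_scalar hW.stronglyMeasurable _ i) t _
  have m₄ : AEStronglyMeasurable f₄ μ₁ :=
    aestronglyMeasurable_slice_of_uncurry (stronglyMeasurable_uncurry_divPotential_selfStretch hW) t _
  have h32 : (1 : ℝ≥0∞) ≤ 3 / 2 := by
    rw [ENNReal.le_div_iff_mul_le (by norm_num) (by norm_num)]; norm_num
  -- Minkowski
  have htri : eLpNorm (pressureField W P t) (3 / 2 : ℝ≥0∞) μ₁ ≤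
      eLpNorm f₁ (3 / 2 : ℝ≥0∞) μ₁ + eLpNorm f₂ (3 / 2 : ℝ≥0∞) μ₁ + eLpNorm f₃ (3 / 2 : ℝ≥0∞) μ₁ +
        eLpNorm f₄ (3 / 2 : ℝ≥0∞) μ₁ := by
    rw [e]
    calc eLpNorm (f₁ - f₂ - f₃ + f₄) (3 / 2 : ℝ≥0∞) μ₁
        ≤ eLpNorm (f₁ - f₂ - f₃) (3 / 2 : ℝ≥0∞) μ₁ + eLpNorm f₄ (3 / 2 : ℝ≥0∞) μ₁ :=
          eLpNorm_add_le ((m₁.sub m₂).sub m₃) m₄ h32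
      _ ≤ eLpNorm (f₁ - f₂) (3 / 2 : ℝ≥0∞) μ₁ + eLpNorm f₃ (3 / 2 : ℝ≥0∞) μ₁ +
            eLpNorm f₄ (3 / 2 : ℝ≥0∞) μ₁ := by
          gcongr; exact eLpNorm_sub_le (m₁.sub m₂) m₃ h32
      _ ≤ _ := by gcongr; exact eLpNorm_sub_le m₁ m₂ h32
  -- the Calderón–Zygmund piece
  have h1 : eLpNorm f₁ (3 / 2 : ℝ≥0∞) μ₁ ≤ (1 + L) * eLpNorm (P t) (3 / 2 : ℝ≥0∞) volume :=
    (eLpNorm_mono_measure f₁ Measure.restrict_le_self).trans (eLpNorm_sub_newtonFarSmoothing_le hPt)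
  -- the sup-bounded pieces
  have hbd : ∀ {g : EuclideanSpace ℝ (Fin 3) → ℝ} {M : ℝ}, (∀ y, ‖g y‖ ≤ M) →
      eLpNorm g (3 / 2 : ℝ≥0∞) μ₁ ≤ V * ENNReal.ofReal M := by
    intro g M hg
    have h := eLpNorm_le_of_ae_bound (μ := μ₁) (p := (3 / 2 : ℝ≥0∞)) (Eventually.of_forall hg)
    rwa [hμ₁, Measure.restrict_apply_univ, toReal_threeHalves_inv] at h
  have h2 : eLpNorm f₂ (3 / 2 : ℝ≥0∞) μ₁ ≤ V * ENNReal.ofReal (Csh * S) :=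
    hbd fun y => hCsh (W t) (hW.aestronglyMeasurable_slice t) (hW.integrable_sq t) y
  have h3 : eLpNorm f₃ (3 / 2 : ℝ≥0∞) μ₁ ≤ V * ENNReal.ofReal (3 * Ccv * S) := by
    refine hbd fun y => ?_
    calc ‖f₃ y‖ ≤ ∑ i, ‖((fun z => fderiv ℝ annularKernel z (EuclideanSpace.single (i : Fin 3) (1 : ℝ))) ⋆
          scalarDensity (fun x => W t x i • W t x)) y‖ := norm_sum_le _ _
      _ ≤ ∑ _i : Fin 3, Ccv * S := Finset.sum_le_sum fun i _ =>
          hCcv (W t) (hW.aestronglyMeasurable_slice t) (hW.integrable_sq t) i y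
      _ = 3 * Ccv * S := by
          simp only [Finset.sum_const, Finset.card_univ, Fintype.card_fin, nsmul_eq_mul]
          push_cast; ring
  have h4 : eLpNorm f₄ (3 / 2 : ℝ≥0∞) μ₁ ≤ V * ENNReal.ofReal (Cπ * I ^ 2) :=
    hbd fun y => by rw [Real.norm_eq_abs]; exact hCπ (W t) (hW.integrableOn_slice t) y
  -- summing up
  have hsum : ENNReal.ofReal (Csh * S) + ENNReal.ofReal (3 * Ccv * S) + ENNReal.ofReal (Cπ * I ^ 2) ≤
      ENNReal.ofReal ((Csh + 3 * Ccv + Cπ) * (S + I ^ 2)) := by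
    rw [← ENNReal.ofReal_add (by positivity) (by positivity),
      ← ENNReal.ofReal_add (by positivity) (by positivity)]
    exact ENNReal.ofReal_le_ofReal (by nlinarith [sq_nonneg I])
  calc eLpNorm (pressureField W P t) (3 / 2 : ℝ≥0∞) μ₁
      ≤ eLpNorm f₁ (3 / 2 : ℝ≥0∞) μ₁ + eLpNorm f₂ (3 / 2 : ℝ≥0∞) μ₁ + eLpNorm f₃ (3 / 2 : ℝ≥0∞) μ₁ +
        eLpNorm f₄ (3 / 2 : ℝ≥0∞) μ₁ := htri
    _ ≤ (1 + L) * eLpNorm (P t) (3 / 2 : ℝ≥0∞) volume + V * ENNReal.ofReal (Csh * S) +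
          V * ENNReal.ofReal (3 * Ccv * S) + V * ENNReal.ofReal (Cπ * I ^ 2) :=
        add_le_add (add_le_add (add_le_add h1 h2) h3) h4
    _ = (1 + L) * eLpNorm (P t) (3 / 2 : ℝ≥0∞) volume + V * (ENNReal.ofReal (Csh * S) +
          ENNReal.ofReal (3 * Ccv * S) + ENNReal.ofReal (Cπ * I ^ 2)) := by ring
    _ ≤ (1 + L) * eLpNorm (P t) (3 / 2 : ℝ≥0∞) volume +
          V * ENNReal.ofReal ((Csh + 3 * Ccv + Cπ) * (S + I ^ 2)) :=
        by gcongr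

end Slice

/-! ### Space–time: the class `q ∈ L^{3/2}((−4,0) × B₁)` and (est.q) on `Q₁(0)` -/

section SpaceTime

variable {W : ℝ → EuclideanSpace ℝ (Fin 3) → EuclideanSpace ℝ (Fin 3)} {P : ℝ → EuclideanSpace ℝ (Fin 3) → ℝ}

/-- `Q₂(0) = (−4, 0) × B₂`. [folklore] -/
private theorem parabolicCylinder_two_zero :
    parabolicCylinder 2 (0 : ℝ × EuclideanSpace ℝ (Fin 3)) =
      Ioo (-4 : ℝ) 0 ×ˢ ball (0 : EuclideanSpace ℝ (Fin 3)) 2 := by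
  rw [parabolicCylinder]
  norm_num

/-- `Q₁(0) = (−1, 0) × B₁`. [folklore] -/
private theorem parabolicCylinder_one_zero :
    parabolicCylinder 1 (0 : ℝ × EuclideanSpace ℝ (Fin 3)) =
      Ioo (-1 : ℝ) 0 ×ˢ ball (0 : EuclideanSpace ℝ (Fin 3)) 1 := by
  rw [parabolicCylinder]
  norm_num

/-- The slices of a good velocity are supported in `B₂`. [folklore] -/
private theorem support_slice_subset (hW : IsGoodVelocity W) (t : ℝ) :
    support (W t) ⊆ ball (0 : EuclideanSpace ℝ (Fin 3)) 2 := fun x hx => by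
  by_contra h
  exact hx (hW.eq_zero t x h)

/-- `‖W(t)‖_{L³(ℝ³)} = ‖W(t)‖_{L³(B₂)}`. [folklore] -/
private theorem eLpNorm_slice_eq_restrict (hW : IsGoodVelocity W) (t : ℝ) (p : ℝ≥0∞) :
    eLpNorm (W t) p volume = eLpNorm (W t) p (volume.restrict (ball (0 : EuclideanSpace ℝ (Fin 3)) 2)) :=
  (eLpNorm_restrict_eq_of_support_subset (support_slice_subset hW t)).symm

/-- Hölder on `B₂`: `∫_{B₂} ‖W(t)‖ ≤ |B₂|^{2/3} ‖W(t)‖_{L³(B₂)}`, in `ℝ≥0∞`. [folklore] -/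
private theorem ofReal_integral_ball_norm_le (hW : IsGoodVelocity W) (t : ℝ) :
    ENNReal.ofReal (∫ y in ball (0 : EuclideanSpace ℝ (Fin 3)) 2, ‖W t y‖) ≤
      volume (ball (0 : EuclideanSpace ℝ (Fin 3)) 2) ^ (2 / 3 : ℝ) *
        eLpNorm (W t) 3 (volume.restrict (ball (0 : EuclideanSpace ℝ (Fin 3)) 2)) := by
  rw [ofReal_integral_norm_eq_lintegral_enorm (hW.integrableOn_slice t),
    ← eLpNorm_one_eq_lintegral_enorm]
  have h := eLpNorm_le_eLpNorm_mul_rpow_measure_univ (p := 1) (q := 3)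
    (μ := volume.restrict (ball (0 : EuclideanSpace ℝ (Fin 3)) 2)) (by norm_num)
    ((hW.aestronglyMeasurable_slice t).restrict)
  rw [Measure.restrict_apply_univ] at h
  have e : (1 / (1 : ℝ≥0∞).toReal - 1 / (3 : ℝ≥0∞).toReal : ℝ) = 2 / 3 := by norm_num
  rw [e] at h
  rw [mul_comm]
  exact h

/-- Hölder on `B₂`: `∫ ‖W(t)‖² ≤ |B₂|^{1/3} ‖W(t)‖²_{L³(B₂)}`, in `ℝ≥0∞`. [folklore] -/
private theorem ofReal_integral_sq_le (hW : IsGoodVelocity W) (t : ℝ) :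
    ENNReal.ofReal (∫ y, ‖W t y‖ ^ 2) ≤
      volume (ball (0 : EuclideanSpace ℝ (Fin 3)) 2) ^ (1 / 3 : ℝ) *
        eLpNorm (W t) 3 (volume.restrict (ball (0 : EuclideanSpace ℝ (Fin 3)) 2)) ^ 2 := by
  set μ₂ : Measure (EuclideanSpace ℝ (Fin 3)) := volume.restrict (ball (0 : EuclideanSpace ℝ (Fin 3)) 2)
    with hμ₂
  have hint : ∫ y, ‖W t y‖ ^ 2 = ∫ y in ball (0 : EuclideanSpace ℝ (Fin 3)) 2, ‖W t y‖ ^ 2 :=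
    (setIntegral_eq_integral_of_forall_compl_eq_zero fun y hy => by
      rw [hW.eq_zero t y hy, norm_zero]; ring).symm
  have h2 : ENNReal.ofReal (∫ y in ball (0 : EuclideanSpace ℝ (Fin 3)) 2, ‖W t y‖ ^ 2) =
      eLpNorm (W t) 2 μ₂ ^ 2 := by
    rw [ofReal_integral_eq_lintegral_ofReal (hW.integrable_sq t).integrableOn
      (Eventually.of_forall fun y => by positivity)]
    have e : ∀ y, ENNReal.ofReal (‖W t y‖ ^ 2) = ‖W t y‖ₑ ^ (2 : ℝ) := fun y => by
      rw [ENNReal.ofReal_pow (norm_nonneg _), ofReal_norm, ← ENNReal.rpow_natCast]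
      norm_num
    simp_rw [e]
    rw [← hμ₂, eLpNorm_eq_lintegral_rpow_enorm_toReal (by norm_num) (by norm_num), ENNReal.toReal_ofNat,
      ← ENNReal.rpow_natCast, ← ENNReal.rpow_mul]
    norm_num
  have h := eLpNorm_le_eLpNorm_mul_rpow_measure_univ (p := 2) (q := 3) (μ := μ₂) (by norm_num)
    ((hW.aestronglyMeasurable_slice t).restrict)
  rw [hμ₂, Measure.restrict_apply_univ] at h
  have e : (1 / (2 : ℝ≥0∞).toReal - 1 / (3 : ℝ≥0∞).toReal : ℝ) = 1 / 6 := by norm_num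
  rw [e, ← hμ₂] at h
  rw [hint, h2]
  calc eLpNorm (W t) 2 μ₂ ^ 2
      ≤ (eLpNorm (W t) 3 μ₂ * volume (ball (0 : EuclideanSpace ℝ (Fin 3)) 2) ^ (1 / 6 : ℝ)) ^ 2 := by
        gcongr
    _ = volume (ball (0 : EuclideanSpace ℝ (Fin 3)) 2) ^ (1 / 3 : ℝ) * eLpNorm (W t) 3 μ₂ ^ 2 := by
        rw [mul_pow, ← ENNReal.rpow_natCast (volume _ ^ (1 / 6 : ℝ)), ← ENNReal.rpow_mul]
        norm_num
        rw [mul_comm]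

/-- `‖W(t)‖³_{L³(B₂)} = ∫_{B₂} ‖W(t)‖³`. [folklore] -/
private theorem eLpNorm_three_rpow (w : EuclideanSpace ℝ (Fin 3) → EuclideanSpace ℝ (Fin 3))
    (μ : Measure (EuclideanSpace ℝ (Fin 3))) :
    eLpNorm w 3 μ ^ (3 : ℝ) = ∫⁻ y, ‖w y‖ₑ ^ (3 : ℝ) ∂μ := by
  rw [eLpNorm_eq_lintegral_rpow_enorm_toReal (by norm_num) (by norm_num), ENNReal.toReal_ofNat,
    ← ENNReal.rpow_mul]
  norm_num

/-- `‖g‖^{3/2}_{L^{3/2}} = ∫ ‖g‖^{3/2}`. [folklore] -/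
private theorem eLpNorm_threeHalves_rpow {α : Type*} [MeasurableSpace α] (g : α → ℝ) (μ : Measure α) :
    eLpNorm g (3 / 2 : ℝ≥0∞) μ ^ (3 / 2 : ℝ) = ∫⁻ y, ‖g y‖ₑ ^ (3 / 2 : ℝ) ∂μ := by
  have e : (3 / 2 : ℝ≥0∞).toReal = 3 / 2 := by rw [ENNReal.toReal_div]; norm_num
  rw [eLpNorm_eq_lintegral_rpow_enorm_toReal (by norm_num) (ENNReal.div_lt_top (by norm_num) (by norm_num)).ne,
    e, ← ENNReal.rpow_mul]
  norm_num

/-- **Core space–time estimate.** There is an absolute constant `c < ∞` such that for every good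
velocity `W`, every jointly measurable representative `P` of the Riesz pressures of the weighted
slices with Stein's slice bound `‖P(t)‖_{3/2} ≤ C_S‖W(t)‖₃²` for a.e. `t ∈ (−4,0)`
(`exists_rieszRepresentative`), and every measurable set of times `T ⊆ (−4,0)`,
`∫∫_{T × B₁} |q|^{3/2} ≤ c ∫∫_{T × B₂} |W|³` for Kwon's pressure `q = pressureField W P`
(slice estimate, raised to the power `3/2`, and Tonelli). [cite: Kwon2023RolePressure, Lemma 2.5 (est.q) with r = 3] -/
theorem exists_setLIntegral_pressureField_le :
    ∃ c : ℝ≥0∞, c ≠ ⊤ ∧ ∀ (W : ℝ → EuclideanSpace ℝ (Fin 3) → EuclideanSpace ℝ (Fin 3))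
      (P : ℝ → EuclideanSpace ℝ (Fin 3) → ℝ), IsGoodVelocity W → StronglyMeasurable (uncurry P) →
      (∀ᵐ t ∂(volume.restrict (Ioo (-4 : ℝ) 0)),
        eLpNorm (P t) (3 / 2 : ℝ≥0∞) volume ≤ steinConstThreeHalves * eLpNorm (W t) 3 volume ^ 2) →
      ∀ {T : Set ℝ}, MeasurableSet T → T ⊆ Ioo (-4 : ℝ) 0 →
        ∫⁻ z in T ×ˢ ball (0 : EuclideanSpace ℝ (Fin 3)) 1, ‖pressureField W P z.1 z.2‖ₑ ^ (3 / 2 : ℝ) ≤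
          c * ∫⁻ z in T ×ˢ ball (0 : EuclideanSpace ℝ (Fin 3)) 2, ‖W z.1 z.2‖ₑ ^ (3 : ℝ) := by
  obtain ⟨A, hA0, hA⟩ := exists_eLpNorm_pressureField_slice_le
  -- the constants
  set B₁ : Set (EuclideanSpace ℝ (Fin 3)) := ball (0 : EuclideanSpace ℝ (Fin 3)) 1 with hB₁
  set B₂ : Set (EuclideanSpace ℝ (Fin 3)) := ball (0 : EuclideanSpace ℝ (Fin 3)) 2 with hB₂
  have hB₁fin : volume B₁ ≠ ⊤ := measure_ball_lt_top.ne
  have hB₂fin : volume B₂ ≠ ⊤ := measure_ball_lt_top.ne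
  set L : ℝ≥0∞ := eLpNorm (newtonFarLaplacian 3 4) 1 (volume : Measure (EuclideanSpace ℝ (Fin 3))) with hL
  have hLtop : L ≠ ⊤ := eLpNorm_newtonFarLaplacian_one_lt_top.ne
  set c₀ : ℝ≥0∞ := (1 + L) * steinConstThreeHalves +
    volume B₁ ^ (2 / 3 : ℝ) * ENNReal.ofReal A * (volume B₂ ^ (1 / 3 : ℝ) + volume B₂ ^ (4 / 3 : ℝ)) with hc₀
  have hc₀top : c₀ ≠ ⊤ := by
    rw [hc₀]
    refine ENNReal.add_ne_top.2 ⟨ENNReal.mul_ne_top (ENNReal.add_ne_top.2 ⟨ENNReal.one_ne_top, hLtop⟩)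
      ENNReal.coe_ne_top, ENNReal.mul_ne_top (ENNReal.mul_ne_top
        (ENNReal.rpow_ne_top_of_nonneg (by norm_num) hB₁fin) ENNReal.ofReal_ne_top)
        (ENNReal.add_ne_top.2 ⟨ENNReal.rpow_ne_top_of_nonneg (by norm_num) hB₂fin,
          ENNReal.rpow_ne_top_of_nonneg (by norm_num) hB₂fin⟩)⟩
  refine ⟨c₀ ^ (3 / 2 : ℝ), ENNReal.rpow_ne_top_of_nonneg (by norm_num) hc₀top,
    fun W P hW hPm hSt T hT hTsub => ?_⟩
  set μ₁ : Measure (EuclideanSpace ℝ (Fin 3)) := volume.restrict B₁ with hμ₁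
  set μ₂ : Measure (EuclideanSpace ℝ (Fin 3)) := volume.restrict B₂ with hμ₂
  set N : ℝ → ℝ≥0∞ := fun t => eLpNorm (W t) 3 μ₂ with hN
  -- ### the slice bound, for a.e. `t ∈ T`
  have hslice : ∀ᵐ t ∂(volume.restrict T),
      ∫⁻ y in B₁, ‖pressureField W P t y‖ₑ ^ (3 / 2 : ℝ) ≤
        c₀ ^ (3 / 2 : ℝ) * ∫⁻ y in B₂, ‖W t y‖ₑ ^ (3 : ℝ) := by
    filter_upwards [ae_restrict_of_ae_restrict_of_subset hTsub hSt] with t ht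
    have hNt : eLpNorm (W t) 3 volume = N t := eLpNorm_slice_eq_restrict hW t 3
    -- `‖q(t)‖_{L^{3/2}(B₁)} ≤ c₀ N(t)²`
    have hq : eLpNorm (pressureField W P t) (3 / 2 : ℝ≥0∞) μ₁ ≤ c₀ * N t ^ 2 := by
      refine (hA W P hW hPm t).trans ?_
      have hP : (1 + L) * eLpNorm (P t) (3 / 2 : ℝ≥0∞) volume ≤ (1 + L) * steinConstThreeHalves * N t ^ 2 := by
        rw [mul_assoc]; gcongr; rwa [← hNt]
      have hSI : ENNReal.ofReal (A * ((∫ x, ‖W t x‖ ^ 2) + (∫ x in B₂, ‖W t x‖) ^ 2)) ≤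
          ENNReal.ofReal A * ((volume B₂ ^ (1 / 3 : ℝ) + volume B₂ ^ (4 / 3 : ℝ)) * N t ^ 2) := by
        rw [ENNReal.ofReal_mul hA0, ENNReal.ofReal_add (integral_nonneg fun x => by positivity) (sq_nonneg _),
          ENNReal.ofReal_pow (integral_nonneg fun x => norm_nonneg _)]
        gcongr
        rw [add_mul]
        refine add_le_add (ofReal_integral_sq_le hW t) ?_
        calc ENNReal.ofReal (∫ x in B₂, ‖W t x‖) ^ 2 ≤ (volume B₂ ^ (2 / 3 : ℝ) * N t) ^ 2 := by
              gcongr; exact ofReal_integral_ball_norm_le hW t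
          _ = volume B₂ ^ (4 / 3 : ℝ) * N t ^ 2 := by
              rw [mul_pow, ← ENNReal.rpow_natCast (volume B₂ ^ (2 / 3 : ℝ)), ← ENNReal.rpow_mul]
              norm_num
      calc (1 + L) * eLpNorm (P t) (3 / 2 : ℝ≥0∞) volume + volume B₁ ^ (2 / 3 : ℝ) *
            ENNReal.ofReal (A * ((∫ x, ‖W t x‖ ^ 2) + (∫ x in B₂, ‖W t x‖) ^ 2))
          ≤ (1 + L) * steinConstThreeHalves * N t ^ 2 + volume B₁ ^ (2 / 3 : ℝ) *
            (ENNReal.ofReal A * ((volume B₂ ^ (1 / 3 : ℝ) + volume B₂ ^ (4 / 3 : ℝ)) * N t ^ 2)) :=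
            add_le_add hP (by gcongr)
        _ = c₀ * N t ^ 2 := by rw [hc₀]; ring
    -- raise to the power `3/2`
    rw [← hμ₁, ← eLpNorm_threeHalves_rpow, ← hμ₂, ← eLpNorm_three_rpow]
    calc eLpNorm (pressureField W P t) (3 / 2 : ℝ≥0∞) μ₁ ^ (3 / 2 : ℝ)
        ≤ (c₀ * N t ^ 2) ^ (3 / 2 : ℝ) := by gcongr
      _ = c₀ ^ (3 / 2 : ℝ) * N t ^ (3 : ℝ) := by
          rw [ENNReal.mul_rpow_of_nonneg _ _ (by norm_num), ← ENNReal.rpow_natCast (N t),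
            ← ENNReal.rpow_mul]
          norm_num
  -- ### Tonelli
  have hmq : AEMeasurable (fun z : ℝ × EuclideanSpace ℝ (Fin 3) => ‖pressureField W P z.1 z.2‖ₑ ^ (3 / 2 : ℝ))
      (((volume : Measure ℝ).prod (volume : Measure (EuclideanSpace ℝ (Fin 3)))).restrict (T ×ˢ B₁)) :=
    ((stronglyMeasurable_uncurry_pressureField hW hPm).measurable.enorm.pow_const _).aemeasurable
  have hmW : AEMeasurable (fun z : ℝ × EuclideanSpace ℝ (Fin 3) => ‖W z.1 z.2‖ₑ ^ (3 : ℝ))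
      (((volume : Measure ℝ).prod (volume : Measure (EuclideanSpace ℝ (Fin 3)))).restrict (T ×ˢ B₂)) :=
    (hW.stronglyMeasurable.measurable.enorm.pow_const _).aemeasurable
  rw [Measure.volume_eq_prod, setLIntegral_prod _ hmq, setLIntegral_prod _ hmW,
    ← lintegral_const_mul' _ _ (ENNReal.rpow_ne_top_of_nonneg (by norm_num) hc₀top)]
  exact lintegral_mono_ae hslice

/-- **The pressure class of Def. 2.4 for Kwon's pressure**: `q = pressureField W P ∈ L^{3/2}` of
`(−4, 0) × B₁` (Lemma 2.5: "`v` solves (per.NS) in `(−4,0) × B₁` … with `q ∈ L^{3/2}`",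
from (est.q) and `u ∈ L³(Q₂)`). [cite: Kwon2023RolePressure, Lemma 2.5 (est.q) with Def. 2.4] -/
theorem lintegral_pressureField_rpow_lt_top (hW : IsGoodVelocity W) (hPm : StronglyMeasurable (uncurry P))
    (hSt : ∀ᵐ t ∂(volume.restrict (Ioo (-4 : ℝ) 0)),
      eLpNorm (P t) (3 / 2 : ℝ≥0∞) volume ≤ steinConstThreeHalves * eLpNorm (W t) 3 volume ^ 2) :
    ∫⁻ z in Ioo (-4 : ℝ) 0 ×ˢ ball (0 : EuclideanSpace ℝ (Fin 3)) 1,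
      ‖pressureField W P z.1 z.2‖ₑ ^ (3 / 2 : ℝ) < ⊤ := by
  obtain ⟨c, hctop, hc⟩ := exists_setLIntegral_pressureField_le
  refine (hc W P hW hPm hSt measurableSet_Ioo Subset.rfl).trans_lt ?_
  refine ENNReal.mul_lt_top hctop.lt_top ?_
  refine (setLIntegral_le_lintegral _ _).trans_lt ?_
  have e : ∀ z : ℝ × EuclideanSpace ℝ (Fin 3), ‖W z.1 z.2‖ₑ ^ (3 : ℝ) = ‖uncurry W z‖ₑ ^ (3 : ℕ) := fun z => by
    rw [← ENNReal.rpow_natCast]; norm_num; rfl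
  simp_rw [e]
  exact hW.lintegral_cube_lt_top

/-- **The `pressure` field of `Kwon2023.IsPerturbedSuitableOn O … q`** for `q = pressureField W P`
on any region `O ⊆ (−4, 0) × B₁` (e.g. `Q₁(0)`): `∫∫_O |q|^{3/2} < ∞`. [cite: Kwon2023RolePressure, Lemma 2.5 (est.q) with Def. 2.4] -/
theorem setLIntegral_pressureField_rpow_lt_top (hW : IsGoodVelocity W) (hPm : StronglyMeasurable (uncurry P))
    (hSt : ∀ᵐ t ∂(volume.restrict (Ioo (-4 : ℝ) 0)),
      eLpNorm (P t) (3 / 2 : ℝ≥0∞) volume ≤ steinConstThreeHalves * eLpNorm (W t) 3 volume ^ 2)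
    {O : Set (ℝ × EuclideanSpace ℝ (Fin 3))}
    (hO : O ⊆ Ioo (-4 : ℝ) 0 ×ˢ ball (0 : EuclideanSpace ℝ (Fin 3)) 1) :
    ∫⁻ z in O, ‖pressureField W P z.1 z.2‖ₑ ^ (3 / 2 : ℝ) < ⊤ :=
  (lintegral_mono_set hO).trans_lt (lintegral_pressureField_rpow_lt_top hW hPm hSt)

/-- **Kwon's pressure is integrable on `(−4, 0) × B₁`** (`L^{3/2} ⊂ L¹` on a bounded region).
[cite: Kwon2023RolePressure, Lemma 2.5 (est.q) with Def. 2.4] -/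
theorem integrableOn_pressureField (hW : IsGoodVelocity W) (hPm : StronglyMeasurable (uncurry P))
    (hSt : ∀ᵐ t ∂(volume.restrict (Ioo (-4 : ℝ) 0)),
      eLpNorm (P t) (3 / 2 : ℝ≥0∞) volume ≤ steinConstThreeHalves * eLpNorm (W t) 3 volume ^ 2) :
    IntegrableOn (uncurry (pressureField W P))
      (Ioo (-4 : ℝ) 0 ×ˢ ball (0 : EuclideanSpace ℝ (Fin 3)) 1) volume := by
  set S : Set (ℝ × EuclideanSpace ℝ (Fin 3)) := Ioo (-4 : ℝ) 0 ×ˢ ball (0 : EuclideanSpace ℝ (Fin 3)) 1 with hS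
  have hSfin : volume S ≠ ⊤ := by
    rw [hS, Measure.volume_eq_prod, Measure.prod_prod]
    exact ENNReal.mul_ne_top measure_Ioo_lt_top.ne measure_ball_lt_top.ne
  haveI : IsFiniteMeasure (volume.restrict S) := isFiniteMeasure_restrict.2 hSfin
  have hmem : MemLp (uncurry (pressureField W P)) (3 / 2 : ℝ≥0∞) (volume.restrict S) := by
    refine ⟨(stronglyMeasurable_uncurry_pressureField hW hPm).aestronglyMeasurable, ?_⟩
    rw [eLpNorm_lt_top_iff_lintegral_rpow_enorm_lt_top (by norm_num)
      (ENNReal.div_lt_top (by norm_num) (by norm_num)).ne]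
    have e : (3 / 2 : ℝ≥0∞).toReal = 3 / 2 := by rw [ENNReal.toReal_div]; norm_num
    rw [e]
    exact lintegral_pressureField_rpow_lt_top hW hPm hSt
  have h32 : (1 : ℝ≥0∞) ≤ 3 / 2 := by
    rw [ENNReal.le_div_iff_mul_le (by norm_num) (by norm_num)]; norm_num
  exact hmem.integrable h32

/-- **The `locallyIntegrableOn_pressure` field of `Kwon2023.IsPerturbedSuitableOn O … q`** for
`q = pressureField W P` on any region `O ⊆ (−4, 0) × B₁`. [cite: Kwon2023RolePressure, Lemma 2.5 (est.q) with Def. 2.4] -/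
theorem locallyIntegrableOn_pressureField (hW : IsGoodVelocity W) (hPm : StronglyMeasurable (uncurry P))
    (hSt : ∀ᵐ t ∂(volume.restrict (Ioo (-4 : ℝ) 0)),
      eLpNorm (P t) (3 / 2 : ℝ≥0∞) volume ≤ steinConstThreeHalves * eLpNorm (W t) 3 volume ^ 2)
    {O : Set (ℝ × EuclideanSpace ℝ (Fin 3))}
    (hO : O ⊆ Ioo (-4 : ℝ) 0 ×ˢ ball (0 : EuclideanSpace ℝ (Fin 3)) 1) :
    LocallyIntegrableOn (uncurry (pressureField W P)) O volume :=
  ((integrableOn_pressureField hW hPm hSt).mono_set hO).locallyIntegrableOn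

/-- **(est.q) at `r = m = 3`, in the form of the §4 assembly.** There is an absolute `C > 0` such
that for every good velocity `W` (a representative of the velocity on `Q₂(0) = (−4,0) × B₂`, zero
off `B₂`) and every jointly measurable representative `P` of the Riesz pressures of the weighted
slices with Stein's slice bound (`exists_rieszRepresentative`), Kwon's pressure satisfies
`‖q‖_{L^{3/2}(Q₁(0))} ≤ C ‖W‖²_{L³(Q₂(0))}` — Lemma 2.5 (est.q)
"`‖q‖_{L^{r/2}_tL^{m/2}_x(Q₁)} ≲ ‖u‖²_{L^r_tL^m_x(Q₂)}`" with `r = m = 3`, as used in §4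
("`‖q‖_{L^{r/2}_tL^{m/2}_x(Q₁)} ≤ C₁‖u‖²_{L^r_tL^m_x(Q₂)}`").
[cite: Kwon2023RolePressure, Lemma 2.5 (est.q) with r = m = 3; §4 (arXiv p. 15)] -/
theorem exists_eLpNorm_pressureField_le :
    ∃ C : ℝ, 0 < C ∧ ∀ (W : ℝ → EuclideanSpace ℝ (Fin 3) → EuclideanSpace ℝ (Fin 3))
      (P : ℝ → EuclideanSpace ℝ (Fin 3) → ℝ), IsGoodVelocity W → StronglyMeasurable (uncurry P) →
      (∀ᵐ t ∂(volume.restrict (Ioo (-4 : ℝ) 0)),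
        eLpNorm (P t) (3 / 2 : ℝ≥0∞) volume ≤ steinConstThreeHalves * eLpNorm (W t) 3 volume ^ 2) →
      eLpNorm (uncurry (pressureField W P)) (3 / 2 : ℝ≥0∞)
          (volume.restrict (parabolicCylinder 1 (0 : ℝ × EuclideanSpace ℝ (Fin 3)))) ≤
        ENNReal.ofReal C * eLpNorm (uncurry W) 3
          (volume.restrict (parabolicCylinder 2 (0 : ℝ × EuclideanSpace ℝ (Fin 3)))) ^ 2 := by
  obtain ⟨c, hctop, hc⟩ := exists_setLIntegral_pressureField_le
  have hc23 : c ^ (2 / 3 : ℝ) ≠ ⊤ := ENNReal.rpow_ne_top_of_nonneg (by norm_num) hctop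
  refine ⟨(c ^ (2 / 3 : ℝ)).toReal + 1, by positivity, fun W P hW hPm hSt => ?_⟩
  set μ₁ : Measure (ℝ × EuclideanSpace ℝ (Fin 3)) :=
    volume.restrict (parabolicCylinder 1 (0 : ℝ × EuclideanSpace ℝ (Fin 3))) with hμ₁
  set μ₂ : Measure (ℝ × EuclideanSpace ℝ (Fin 3)) :=
    volume.restrict (parabolicCylinder 2 (0 : ℝ × EuclideanSpace ℝ (Fin 3))) with hμ₂
  set X : ℝ≥0∞ := eLpNorm (uncurry W) 3 μ₂ with hXdef
  have hkey := hc W P hW hPm hSt (measurableSet_Ioo (a := (-1 : ℝ)) (b := 0))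
    (Ioo_subset_Ioo (by norm_num) le_rfl)
  -- the left side is `‖q‖^{3/2}_{L^{3/2}(Q₁(0))}`, the right side is at most `c X³`
  have hL : eLpNorm (uncurry (pressureField W P)) (3 / 2 : ℝ≥0∞) μ₁ ^ (3 / 2 : ℝ) =
      ∫⁻ z in Ioo (-1 : ℝ) 0 ×ˢ ball (0 : EuclideanSpace ℝ (Fin 3)) 1,
        ‖pressureField W P z.1 z.2‖ₑ ^ (3 / 2 : ℝ) := by
    rw [hμ₁, eLpNorm_threeHalves_rpow, parabolicCylinder_one_zero]
    rfl
  have hR : ∫⁻ z in Ioo (-1 : ℝ) 0 ×ˢ ball (0 : EuclideanSpace ℝ (Fin 3)) 2, ‖W z.1 z.2‖ₑ ^ (3 : ℝ) ≤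
      X ^ (3 : ℝ) := by
    have e : X ^ (3 : ℝ) = ∫⁻ z in parabolicCylinder 2 (0 : ℝ × EuclideanSpace ℝ (Fin 3)),
        ‖uncurry W z‖ₑ ^ (3 : ℝ) := by
      rw [hXdef, hμ₂, eLpNorm_eq_lintegral_rpow_enorm_toReal (by norm_num) (by norm_num),
        ENNReal.toReal_ofNat, ← ENNReal.rpow_mul]
      norm_num
    rw [e, parabolicCylinder_two_zero]
    exact lintegral_mono_set (prod_mono (Ioo_subset_Ioo (by norm_num) le_rfl) Subset.rfl)
  have h32 : eLpNorm (uncurry (pressureField W P)) (3 / 2 : ℝ≥0∞) μ₁ ^ (3 / 2 : ℝ) ≤ c * X ^ (3 : ℝ) := by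
    rw [hL]
    exact hkey.trans (by gcongr)
  have h1 : eLpNorm (uncurry (pressureField W P)) (3 / 2 : ℝ≥0∞) μ₁ =
      (eLpNorm (uncurry (pressureField W P)) (3 / 2 : ℝ≥0∞) μ₁ ^ (3 / 2 : ℝ)) ^ (2 / 3 : ℝ) := by
    rw [← ENNReal.rpow_mul]; norm_num
  rw [h1]
  calc (eLpNorm (uncurry (pressureField W P)) (3 / 2 : ℝ≥0∞) μ₁ ^ (3 / 2 : ℝ)) ^ (2 / 3 : ℝ)
      ≤ (c * X ^ (3 : ℝ)) ^ (2 / 3 : ℝ) := by gcongr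
    _ = c ^ (2 / 3 : ℝ) * X ^ 2 := by
        rw [ENNReal.mul_rpow_of_nonneg _ _ (by norm_num), ← ENNReal.rpow_mul, ← ENNReal.rpow_natCast X]
        norm_num
    _ ≤ ENNReal.ofReal ((c ^ (2 / 3 : ℝ)).toReal + 1) * X ^ 2 := by
        gcongr
        rw [ENNReal.ofReal_add ENNReal.toReal_nonneg zero_le_one, ENNReal.ofReal_toReal hc23]
        exact le_self_add

/-- **Summary for the assembly of Lemma 2.5.** There is an absolute `C > 0` such that every good
velocity `W` admits a jointly measurable representative `P` of the Riesz pressures of its weighted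
slices (`exists_rieszRepresentative`) for which Kwon's pressure `q = pressureField W P` — the
pressure of `momentum_perturbed_pressureField` — is integrable on `(−4,0) × B₁`, lies in
`L^{3/2}((−4,0) × B₁)`, and satisfies (est.q) `‖q‖_{L^{3/2}(Q₁(0))} ≤ C ‖W‖²_{L³(Q₂(0))}`.
[cite: Kwon2023RolePressure, Lemma 2.5 (est.q) with r = m = 3 and Def. 2.4] -/
theorem exists_pressureField_representative :
    ∃ C : ℝ, 0 < C ∧ ∀ (W : ℝ → EuclideanSpace ℝ (Fin 3) → EuclideanSpace ℝ (Fin 3)), IsGoodVelocity W →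
      ∃ P : ℝ → EuclideanSpace ℝ (Fin 3) → ℝ, StronglyMeasurable (uncurry P) ∧
        (∀ᵐ t ∂(volume.restrict (Ioo (-4 : ℝ) 0)), P t =ᵐ[volume] rieszPressure (sqrtCutoffSMul (W t))) ∧
        IntegrableOn (uncurry (pressureField W P))
          (Ioo (-4 : ℝ) 0 ×ˢ ball (0 : EuclideanSpace ℝ (Fin 3)) 1) volume ∧
        (∫⁻ z in Ioo (-4 : ℝ) 0 ×ˢ ball (0 : EuclideanSpace ℝ (Fin 3)) 1,
          ‖pressureField W P z.1 z.2‖ₑ ^ (3 / 2 : ℝ) < ⊤) ∧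
        eLpNorm (uncurry (pressureField W P)) (3 / 2 : ℝ≥0∞)
            (volume.restrict (parabolicCylinder 1 (0 : ℝ × EuclideanSpace ℝ (Fin 3)))) ≤
          ENNReal.ofReal C * eLpNorm (uncurry W) 3
            (volume.restrict (parabolicCylinder 2 (0 : ℝ × EuclideanSpace ℝ (Fin 3)))) ^ 2 := by
  obtain ⟨C, hC0, hC⟩ := exists_eLpNorm_pressureField_le
  refine ⟨C, hC0, fun W hW => ?_⟩
  obtain ⟨P, hPm, -, hP⟩ := exists_rieszRepresentative hW
  have hae : ∀ᵐ t ∂(volume.restrict (Ioo (-4 : ℝ) 0)), P t =ᵐ[volume] rieszPressure (sqrtCutoffSMul (W t)) :=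
    hP.mono fun t ht => ht.1
  have hSt : ∀ᵐ t ∂(volume.restrict (Ioo (-4 : ℝ) 0)),
      eLpNorm (P t) (3 / 2 : ℝ≥0∞) volume ≤ steinConstThreeHalves * eLpNorm (W t) 3 volume ^ 2 :=
    hP.mono fun t ht => ht.2.2
  exact ⟨P, hPm, hae, integrableOn_pressureField hW hPm hSt, lintegral_pressureField_rpow_lt_top hW hPm hSt,
    hC W P hW hPm hSt⟩

end SpaceTime

end Kwon2023

end Literature.Analysis.FluidPDE

end
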